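import Literature.NumberTheory.Sieve.AsymptoticSieveForPrimesS3Rough
import Literature.NumberTheory.Sieve.AsymptoticSieveForPrimesRoughK
import HarnessLib

/-!
# Asymptotic sieve for primes under (B*): the estimate (7.2) of `S₂(x; Y, z)` from the sieved bilinear hypothesis (FI §10 applied to §7)

Topic `Literature/NumberTheory/Sieve` (trunk T-SIEVE), a sequel of
`Literature.NumberTheory.Sieve.AsymptoticSieveForPrimesRough` and `…S3Rough`. Source: J. Friedlander,
H. Iwaniec, *Asymptotic sieve for primes*, Ann. of Math. 148 (1998) 1041–1065 [FriedlanderIwaniecASP1998]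
(= arXiv:math/9811186), §7 (7.1)–(7.2) and §10 (Theorem 3, (10.4)–(10.5), pp. 1063–1065): "To see this
recall that (B) was used solely to estimate the sums `S₂` and `S₃` in Sections 7 and 8. In the case of
`S₂` we note that (7.1) contains such an integration with `y` in place of `w` and `γ(n;t) = 1`. … We
write `n = n₀n₁` where `(n₀, Π) = 1` and `n₁ ∣ Π`. The contribution to (B̃) from terms with `n₁ > Δ` is
estimated trivially … by Rankin's trick … Next we estimate the contribution of terms with `n₁ ≤ Δ` …
change variables `w → wn₁` … By the argument that gave (B) ⟹ (B′) it follows that (B*) implies …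
(the restriction `(n, Π) = 1` only helps matters)."

This file DISCHARGES the named fact `Literature.NumberTheory.Sieve.fi_asp_S2_estimate_rough` (FI (7.2),
`|∫_Y^{eY} S₂(x; y, z) dy/y| ≤ K A(x)/log x`, over `FIRegimeRough`, i.e. with (B*) in place of (B)):
**`fi_asp_S2_estimate_rough_holds`**. Together with `…CoreEstimates`, `…S3Rough` and `…RoughAssembly`
this completes the proof of `fi_asymptotic_sieve_primes_rough_loglog` (Theorem 1 with (B*)), recorded
in the sequel.

## Contents

* `abs_Psi_le_smooth_add_large` — the inner sum `Ψ(ℓ,u) = ∑_{b≤X/ℓ, u<b≤su} μ(b) a_{bℓ}` of (7.1)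
  after `b = n₁n₀` (squarefree `P`-smooth `n₁`, `P`-rough `n₀`; `sum_Icc_eq_sum_sqfree_smooth_sum_rough`),
  split at `n₁ ≤ Δ`;
* `sum_large_smooth_le_rankin_one`, `sum_tau3_sum_tau_sq_le` — the terms `n₁ > Δ`:
  `≤ Δ^{-1/log P} ∑_{n≤x} a_n τ(n)⁶` (`1 ≤ Δ^{-ε}n₁^ε ≤ Δ^{-ε}τ(n₁)²`, `τ₃(ℓ)τ(b)² ≤ τ(n)⁴`, `τ(n)` factorisations);
* `sum_tau3_sum_mul_le` — reindexing `ℓ' = ℓn₁`: `∑_{ℓ∣ℓ'} τ₃(ℓ) = τ₄(ℓ') = 4^{ω(ℓ')} ≤ 6^{ω(ℓ')}` on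
  squarefree `ℓ'`;
* `intervalIntegral_comp_div_le_gen` — `∫_a^b h(y/ν) dy/y ≤ ∫_{a/L}^b h(u) du/u` (`1 ≤ ν ≤ L`);
* `abs_rough_innerS2_le_sum_pieces`, `sum_six_pow_abs_rough_innerS2_le` — the rough inner sums on the
  dyadic pieces of `(v, 2^{k₀}v]`, in the form of `fiBilinearRough` at `C = 1`;
* `fi_asp_S2_estimate_roughK` — the assembly: steps (A)–(D) of the tree's `fi_asp_S2_estimate_holds`
  verbatim, then `∑_ℓ τ₃(ℓ)|Ψ(ℓ,u)| ≤ W₀(u) + W₁`, `W₁ ≤ C₆ A(x)(log x)^{-7}` (Rankin under (10.2),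
  `rankin_rpow_le_log_rpow`), `∫_{Y/Δ}^{eY} W₀(u) du/u ≤ k₀ K_B A(x)(log x)^{-5}(1 + 2 log Δ)` (the second
  integration `u → un₁` down to `Y/Δ² = x^{-3θ/2}√D ≥ x^{-2θ}√D`, the range of (B*) for `Δ_B = x^{2θ}`),
  whence `|S₂(x; Y, z)| ≤ (12K_B + 2C₆) A(x)/log x`; stated with the clauses unbundled and (B*)
  carrying an implied constant `K_B*` (as printed; needed by FI's Theorem 2, §9), the reduced bound
  coming from `…RoughK`; `fi_asp_S2_estimate_rough_holds` — the case `K_B* = 1`, i.e. the named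
  fact over `FIRegimeRough`.

## References

* J. Friedlander, H. Iwaniec, *Asymptotic sieve for primes*, Ann. of Math. 148 (1998), 1041–1065,
  §7 (7.1)–(7.2) and §10 Theorem 3. [cite: FriedlanderIwaniecASP1998, §7 (7.2) and §10 Theorem 3]

## Mathlib / tree search

Tree (reused): `abs_fiS2_le`, `measurable_innerS2`, `abs_innerS2_le`, `intervalIntegral_comp_div_le`,
`sum_card_divisors_mul_sum_le`, `sum_ite_Ioc_pow_eq_sum_range`, `sum_moebius_mul_a_eq`,
`intervalIntegrable_comp_div_div`, `intervalIntegrable_finset_sum_fun`, `nat_le_four_mul_log_of_two_pow_le`,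
`divisorCountK_three_eq` (`…S2`); `window_mul_iff`, `rankin_rpow_le_log_rpow`, `measurable_window_sum`,
`abs_window_sum_le` (`…S3Rough`);
`FIAsymptoticSieveHypothesesCore.reduced_rough_bilinear_bound_six_of_bilinear` (`…RoughK`);
`sum_Icc_eq_sum_sqfree_smooth_sum_rough`, `sum_a_mul_card_divisors_pow_six_le`, Rankin lemmas
(`…SmoothRough`); `sum_sum_le_sum_divisorsAntidiagonal` (`…Reduction`). Mathlib: `Nat.sum_divisorsAntidiagonal`,
`Nat.map_div_right_divisors`, `intervalIntegral.integral_comp_div`. `lean search` for the new names: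
nothing before this file.
-/

noncomputable section

open Filter Finset
open scoped ArithmeticFunction.Moebius ArithmeticFunction.vonMangoldt ArithmeticFunction.zeta
  ArithmeticFunction.omega ArithmeticFunction.sigma

namespace Literature.NumberTheory.Sieve

open MeasureTheory
open scoped Topology

/-! ### The inner sum `Ψ(ℓ, u)` of (7.1) after `b = n₁ n₀` -/

variable {A : SieveSequence} in
/-- **The inner sum of (7.1) after the decomposition `b = n₁n₀`** (FI §10 for the case `γ = 1`: "We
write `n = n₀n₁` where `(n₀, Π) = 1` and `n₁ ∣ Π`"): for `ℓ`, `X`, `u`, `s`, a sieving parameter `P`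
and a threshold `Lw`,
`|∑_{b≤X/ℓ, u<b≤su} μ(b) a_{bℓ}| ≤ ∑_{n₁ ≤ Lw} |∑_{n₀ rough ≤ X/(ℓn₁), u/n₁<n₀≤su/n₁} μ(n₀) a_{n₀(ℓn₁)}|
 + ∑_{n₁ > Lw} ∑_{n₀ rough ≤ X/(ℓn₁)} a_{n₀(ℓn₁)}`, `n₁` running over the squarefree `P`-smooth integers
`≤ X/ℓ` (`μ(b) = 0` off the squarefree `b`; `μ(n₁n₀) = μ(n₁)μ(n₀)`).
[cite: FriedlanderIwaniecASP1998, §10 p. 1064] -/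
theorem abs_Psi_le_smooth_add_large (P Lw : ℝ) (ℓ X : ℕ) (u s : ℝ) :
    |∑ b ∈ Icc 1 (X / ℓ), (if u < (b : ℝ) ∧ (b : ℝ) ≤ s * u then (μ b : ℝ) * A.a (b * ℓ) else 0)| ≤
      (∑ n₁ ∈ (Icc 1 (X / ℓ)).filter (fun n : ℕ => Squarefree n ∧
          (∀ p ∈ n.primeFactors, (p : ℝ) < P) ∧ (n : ℝ) ≤ Lw),
        |∑ n₀ ∈ (Icc 1 (X / (ℓ * n₁))).filter (fun n : ℕ => ∀ p ∈ n.primeFactors, P ≤ (p : ℝ)),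
          (if u / n₁ < (n₀ : ℝ) ∧ (n₀ : ℝ) ≤ s * (u / n₁) then (μ n₀ : ℝ) * A.a (n₀ * (ℓ * n₁)) else 0)|) +
      ∑ n₁ ∈ (Icc 1 (X / ℓ)).filter (fun n : ℕ => Squarefree n ∧
          (∀ p ∈ n.primeFactors, (p : ℝ) < P) ∧ Lw < (n : ℝ)),
        ∑ n₀ ∈ (Icc 1 (X / (ℓ * n₁))).filter (fun n : ℕ => ∀ p ∈ n.primeFactors, P ≤ (p : ℝ)),
          A.a (n₀ * (ℓ * n₁)) := by
  classical
  set f : ℕ → ℝ := fun b => if u < (b : ℝ) ∧ (b : ℝ) ≤ s * u then (μ b : ℝ) * A.a (b * ℓ) else 0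
    with hf
  have hf0 : ∀ c, ¬Squarefree c → f c = 0 := by
    intro c hc
    simp only [hf, ArithmeticFunction.moebius_eq_zero_of_not_squarefree hc, Int.cast_zero,
      zero_mul, ite_self]
  set SM := (Icc 1 (X / ℓ)).filter (fun n : ℕ => Squarefree n ∧ ∀ p ∈ n.primeFactors, (p : ℝ) < P)
    with hSM
  set RO : ℕ → Finset ℕ := fun n₁ =>
    (Icc 1 (X / (ℓ * n₁))).filter (fun n : ℕ => ∀ p ∈ n.primeFactors, P ≤ (p : ℝ)) with hRO
  have hdec : ∑ b ∈ Icc 1 (X / ℓ), f b = ∑ n₁ ∈ SM, ∑ n₀ ∈ RO n₁, f (n₁ * n₀) := by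
    rw [sum_Icc_eq_sum_sqfree_smooth_sum_rough P hf0 (X / ℓ)]
    refine Finset.sum_congr rfl fun n₁ _ => ?_
    rw [hRO, Nat.div_div_eq_div_mul]
  have hsplit : ∑ n₁ ∈ SM, ∑ n₀ ∈ RO n₁, f (n₁ * n₀) =
      (∑ n₁ ∈ SM.filter (fun n : ℕ => (n : ℝ) ≤ Lw), ∑ n₀ ∈ RO n₁, f (n₁ * n₀)) +
      ∑ n₁ ∈ SM.filter (fun n : ℕ => ¬ (n : ℝ) ≤ Lw), ∑ n₀ ∈ RO n₁, f (n₁ * n₀) :=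
    (Finset.sum_filter_add_sum_filter_not SM (fun n : ℕ => (n : ℝ) ≤ Lw) _).symm
  have hS1 : SM.filter (fun n : ℕ => (n : ℝ) ≤ Lw) = (Icc 1 (X / ℓ)).filter (fun n : ℕ =>
      Squarefree n ∧ (∀ p ∈ n.primeFactors, (p : ℝ) < P) ∧ (n : ℝ) ≤ Lw) := by
    rw [hSM, Finset.filter_filter]
    refine Finset.filter_congr fun n _ => ?_
    tauto
  have hS2 : SM.filter (fun n : ℕ => ¬ (n : ℝ) ≤ Lw) = (Icc 1 (X / ℓ)).filter (fun n : ℕ =>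
      Squarefree n ∧ (∀ p ∈ n.primeFactors, (p : ℝ) < P) ∧ Lw < (n : ℝ)) := by
    rw [hSM, Finset.filter_filter]
    refine Finset.filter_congr fun n _ => ?_
    rw [not_le]
    tauto
  -- the inner sum for a fixed smooth squarefree `n₁`
  have hinner : ∀ n₁ ∈ SM, ∑ n₀ ∈ RO n₁, f (n₁ * n₀) = (μ n₁ : ℝ) *
      ∑ n₀ ∈ RO n₁, (if u / n₁ < (n₀ : ℝ) ∧ (n₀ : ℝ) ≤ s * (u / n₁) then
        (μ n₀ : ℝ) * A.a (n₀ * (ℓ * n₁)) else 0) := by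
    intro n₁ hn₁
    obtain ⟨-, hsq, hsm⟩ := Finset.mem_filter.mp hn₁
    have hn₁0 : n₁ ≠ 0 := hsq.ne_zero
    rw [Finset.mul_sum]
    refine Finset.sum_congr rfl fun n₀ hn₀ => ?_
    obtain ⟨hI, hr⟩ := Finset.mem_filter.mp hn₀
    have hn₀0 : n₀ ≠ 0 := Nat.one_le_iff_ne_zero.mp (Finset.mem_Icc.mp hI).1
    have hcop : Nat.Coprime n₁ n₀ := by
      rw [← Nat.disjoint_primeFactors hn₁0 hn₀0]
      exact Finset.disjoint_left.mpr fun p hp hp' => absurd (hsm p hp) (not_lt.mpr (hr p hp'))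
    simp only [hf]
    by_cases hwin : u / n₁ < (n₀ : ℝ) ∧ (n₀ : ℝ) ≤ s * (u / n₁)
    · rw [if_pos ((window_mul_iff (Nat.pos_of_ne_zero hn₁0) n₀ u s).mpr hwin), if_pos hwin,
        ArithmeticFunction.isMultiplicative_moebius.map_mul_of_coprime hcop, Int.cast_mul,
        show n₁ * n₀ * ℓ = n₀ * (ℓ * n₁) by ring]
      ring
    · rw [if_neg (fun h => hwin ((window_mul_iff (Nat.pos_of_ne_zero hn₁0) n₀ u s).mp h)),
        if_neg hwin, mul_zero]
  show |∑ b ∈ Icc 1 (X / ℓ), f b| ≤ _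
  rw [hdec, hsplit, hS1, hS2]
  refine (abs_add_le _ _).trans (add_le_add ?_ ?_)
  · refine (Finset.abs_sum_le_sum_abs _ _).trans (Finset.sum_le_sum fun n₁ hn₁ => ?_)
    have hn₁' : n₁ ∈ SM := by
      obtain ⟨hI, hsq, hsm, -⟩ := Finset.mem_filter.mp hn₁
      exact Finset.mem_filter.mpr ⟨hI, hsq, hsm⟩
    rw [hinner n₁ hn₁', abs_mul]
    have hμ : |(μ n₁ : ℝ)| ≤ 1 := by exact_mod_cast ArithmeticFunction.abs_moebius_le_one
    calc |(μ n₁ : ℝ)| * _ ≤ 1 * _ := mul_le_mul_of_nonneg_right hμ (abs_nonneg _)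
      _ = _ := one_mul _
  · refine (Finset.abs_sum_le_sum_abs _ _).trans (Finset.sum_le_sum fun n₁ _ => ?_)
    refine (Finset.abs_sum_le_sum_abs _ _).trans (Finset.sum_le_sum fun n₀ _ => ?_)
    simp only [hf]
    split_ifs
    · rw [abs_mul, abs_of_nonneg (A.a_nonneg _), show n₁ * n₀ * ℓ = n₀ * (ℓ * n₁) by ring]
      have hμ : |(μ (n₁ * n₀) : ℝ)| ≤ 1 := by exact_mod_cast ArithmeticFunction.abs_moebius_le_one
      calc |(μ (n₁ * n₀) : ℝ)| * A.a (n₀ * (ℓ * n₁)) ≤ 1 * A.a (n₀ * (ℓ * n₁)) :=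
            mul_le_mul_of_nonneg_right hμ (A.a_nonneg _)
        _ = A.a (n₀ * (ℓ * n₁)) := one_mul _
    · rw [abs_zero]; exact A.a_nonneg _

/-! ### `W₁` for (7.1): Rankin's trick and the sixth moment -/

variable {A : SieveSequence} in
/-- **`W₁` by Rankin's trick (case `γ = 1`)**: for `ℓ, X`, `P > 1`, `Lw > 0`, `ε = 1/log P`, under
(1.16), `∑_{n₁ > Lw} ∑_{n₀ rough} a_{n₀(ℓn₁)} ≤ Lw^{-ε} ∑_{b ≤ X/ℓ} τ(b)² a_{bℓ}`.
[cite: FriedlanderIwaniecASP1998, §10 (10.4)] -/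
theorem sum_large_smooth_le_rankin_one (h116 : ∀ n : ℕ, ¬Squarefree n → A.a n = 0) {P Lw : ℝ}
    (hP : 1 < P) (hLw : 0 < Lw) (ℓ X : ℕ) :
    ∑ n₁ ∈ (Icc 1 (X / ℓ)).filter (fun n : ℕ => Squarefree n ∧
        (∀ p ∈ n.primeFactors, (p : ℝ) < P) ∧ Lw < (n : ℝ)),
      ∑ n₀ ∈ (Icc 1 (X / (ℓ * n₁))).filter (fun n : ℕ => ∀ p ∈ n.primeFactors, P ≤ (p : ℝ)),
        A.a (n₀ * (ℓ * n₁)) ≤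
      Lw ^ (-(1 / Real.log P)) * ∑ b ∈ Icc 1 (X / ℓ), ((b.divisors.card : ℝ)) ^ 2 * A.a (b * ℓ) := by
  classical
  set ε : ℝ := 1 / Real.log P with hε
  have hε0 : 0 ≤ ε := by rw [hε]; exact div_nonneg zero_le_one (Real.log_nonneg hP.le)
  have hLε : 0 ≤ Lw ^ (-ε) := Real.rpow_nonneg hLw.le _
  set SM := (Icc 1 (X / ℓ)).filter (fun n : ℕ => Squarefree n ∧ ∀ p ∈ n.primeFactors, (p : ℝ) < P)
    with hSM
  set RO : ℕ → Finset ℕ := fun n₁ =>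
    (Icc 1 (X / (ℓ * n₁))).filter (fun n : ℕ => ∀ p ∈ n.primeFactors, P ≤ (p : ℝ)) with hRO
  set g : ℕ → ℝ := fun b => ((b.divisors.card : ℝ)) ^ 2 * A.a (b * ℓ) with hg
  have hg0 : ∀ c, 0 ≤ g c := fun c => mul_nonneg (by positivity) (A.a_nonneg _)
  have hgsq : ∀ c, ¬Squarefree c → g c = 0 := by
    intro c hc
    have : ¬Squarefree (c * ℓ) := fun h => hc (Squarefree.of_mul_left h)
    simp only [hg, h116 _ this, mul_zero]
  have hdec : ∑ b ∈ Icc 1 (X / ℓ), g b = ∑ n₁ ∈ SM, ∑ n₀ ∈ RO n₁, g (n₁ * n₀) := by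
    rw [sum_Icc_eq_sum_sqfree_smooth_sum_rough P hgsq (X / ℓ)]
    refine Finset.sum_congr rfl fun n₁ _ => ?_
    rw [hRO, Nat.div_div_eq_div_mul]
  rw [hdec, Finset.mul_sum]
  have hsub : (Icc 1 (X / ℓ)).filter (fun n : ℕ => Squarefree n ∧
      (∀ p ∈ n.primeFactors, (p : ℝ) < P) ∧ Lw < (n : ℝ)) ⊆ SM := by
    intro n hn
    obtain ⟨hI, hsq, hsm, -⟩ := Finset.mem_filter.mp hn
    exact Finset.mem_filter.mpr ⟨hI, hsq, hsm⟩
  refine le_trans ?_ (Finset.sum_le_sum_of_subset_of_nonneg hsub fun n₁ _ _ =>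
    mul_nonneg hLε (Finset.sum_nonneg fun n₀ _ => hg0 _))
  refine Finset.sum_le_sum fun n₁ hn₁ => ?_
  obtain ⟨-, hsq, hsm, hbig⟩ := Finset.mem_filter.mp hn₁
  rw [Finset.mul_sum]
  refine Finset.sum_le_sum fun n₀ hn₀ => ?_
  have hn₀0 : n₀ ≠ 0 := Nat.one_le_iff_ne_zero.mp (Finset.mem_Icc.mp (Finset.mem_filter.mp hn₀).1).1
  have h1 : (1 : ℝ) ≤ Lw ^ (-ε) * ((n₁.divisors.card : ℝ)) ^ 2 := by
    calc (1 : ℝ) ≤ Lw ^ (-ε) * (n₁ : ℝ) ^ ε := one_le_rpow_neg_mul_rpow hLw hε0 hbig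
      _ ≤ Lw ^ (-ε) * Real.exp n₁.primeFactors.card :=
          mul_le_mul_of_nonneg_left (rpow_inv_log_le_exp_card_primeFactors hP hsq hsm) hLε
      _ ≤ Lw ^ (-ε) * ((n₁.divisors.card : ℝ)) ^ 2 :=
          mul_le_mul_of_nonneg_left (exp_card_primeFactors_le_card_divisors_sq hsq) hLε
  have hτ : (n₁.divisors.card : ℝ) ≤ ((n₁ * n₀).divisors.card : ℝ) := by
    exact_mod_cast Finset.card_le_card
      (Nat.divisors_subset_of_dvd (mul_ne_zero hsq.ne_zero hn₀0) (Dvd.intro n₀ rfl))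
  have hτ0 : (0 : ℝ) ≤ (n₁.divisors.card : ℝ) := Nat.cast_nonneg _
  simp only [hg]
  rw [show n₁ * n₀ * ℓ = n₀ * (ℓ * n₁) by ring]
  set a := A.a (n₀ * (ℓ * n₁)) with ha
  have ha0 : 0 ≤ a := A.a_nonneg _
  set τ := (((n₁ * n₀).divisors.card : ℝ)) with hτdef
  calc a = 1 * a := (one_mul _).symm
    _ ≤ (Lw ^ (-ε) * ((n₁.divisors.card : ℝ)) ^ 2) * a := mul_le_mul_of_nonneg_right h1 ha0
    _ ≤ (Lw ^ (-ε) * τ ^ 2) * a :=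
        mul_le_mul_of_nonneg_right (mul_le_mul_of_nonneg_left (pow_le_pow_left₀ hτ0 hτ 2) hLε) ha0
    _ = Lw ^ (-ε) * (τ ^ 2 * a) := by ring

/-- `τ₃(ℓ) ≤ τ(ℓ)²` (`τ₃(ℓ) = ∑_{k∣ℓ} τ(k) ≤ τ(ℓ) · τ(ℓ)`). [folklore] -/
theorem divisorCountK_three_le_card_divisors_sq (ℓ : ℕ) :
    (divisorCountK 3 ℓ : ℝ) ≤ ((ℓ.divisors.card : ℝ)) ^ 2 := by
  rcases Nat.eq_zero_or_pos ℓ with rfl | hℓ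
  · simp
  rw [divisorCountK_three_eq, sq]
  calc ∑ k ∈ ℓ.divisors, (k.divisors.card : ℝ) ≤ ∑ _k ∈ ℓ.divisors, (ℓ.divisors.card : ℝ) := by
        refine Finset.sum_le_sum fun k hk => ?_
        exact_mod_cast Finset.card_le_card (Nat.divisors_subset_of_dvd hℓ.ne' (Nat.dvd_of_mem_divisors hk))
    _ = (ℓ.divisors.card : ℝ) * (ℓ.divisors.card : ℝ) := by rw [Finset.sum_const, nsmul_eq_mul]

variable {A : SieveSequence} in
/-- **Gathering the `ℓ`-sum into the sixth divisor moment (case `γ = 1`)**: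
`∑_{ℓ≤X} τ₃(ℓ) ∑_{b≤X/ℓ} τ(b)² a_{bℓ} ≤ ∑_{n≤X} a_n τ(n)⁶` (`τ₃(ℓ) ≤ τ(ℓ)² ≤ τ(n)²`, `τ(b) ≤ τ(n)`,
`τ(n)` factorisations, `τ(n) ≥ 1`). [cite: FriedlanderIwaniecASP1998, §10 (10.4)] -/
theorem sum_tau3_sum_tau_sq_le (X : ℕ) :
    ∑ ℓ ∈ Icc 1 X, (divisorCountK 3 ℓ : ℝ) * ∑ b ∈ Icc 1 (X / ℓ),
        ((b.divisors.card : ℝ)) ^ 2 * A.a (b * ℓ) ≤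
      ∑ n ∈ Ioc 0 X, A.a n * ((n.divisors.card : ℝ)) ^ 6 := by
  classical
  calc ∑ ℓ ∈ Icc 1 X, (divisorCountK 3 ℓ : ℝ) * ∑ b ∈ Icc 1 (X / ℓ),
        ((b.divisors.card : ℝ)) ^ 2 * A.a (b * ℓ)
      = ∑ ℓ ∈ Icc 1 X, ∑ b ∈ Icc 1 (X / ℓ),
          (divisorCountK 3 ℓ : ℝ) * ((b.divisors.card : ℝ)) ^ 2 * A.a (ℓ * b) := by
        refine Finset.sum_congr rfl fun ℓ _ => ?_
        rw [Finset.mul_sum]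
        exact Finset.sum_congr rfl fun b _ => by rw [mul_comm b ℓ]; ring
    _ ≤ ∑ n ∈ Ioc 0 X, ∑ p ∈ n.divisorsAntidiagonal,
          (divisorCountK 3 p.1 : ℝ) * ((p.2.divisors.card : ℝ)) ^ 2 * A.a (p.1 * p.2) := by
        refine sum_sum_le_sum_divisorsAntidiagonal (f := fun ℓ b =>
          (divisorCountK 3 ℓ : ℝ) * ((b.divisors.card : ℝ)) ^ 2 * A.a (ℓ * b))
          (fun ℓ b => mul_nonneg (by positivity) (A.a_nonneg _)) X (Icc 1 X) (fun ℓ => Icc 1 (X / ℓ))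
          fun ℓ hℓ b hb => ?_
        obtain ⟨hℓ1, -⟩ := Finset.mem_Icc.mp hℓ
        obtain ⟨hb1, hbX⟩ := Finset.mem_Icc.mp hb
        refine ⟨hℓ1, hb1, ?_⟩
        have := (Nat.le_div_iff_mul_le hℓ1).mp hbX
        rw [mul_comm] at this
        exact this
    _ ≤ ∑ n ∈ Ioc 0 X, A.a n * ((n.divisors.card : ℝ)) ^ 6 := by
        refine Finset.sum_le_sum fun n hn => ?_
        have hn0 : n ≠ 0 := (Finset.mem_Ioc.mp hn).1.ne'
        have hτ1 : (1 : ℝ) ≤ (n.divisors.card : ℝ) := by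
          exact_mod_cast Finset.one_le_card.mpr ⟨1, Nat.one_mem_divisors.mpr hn0⟩
        have hterm : ∀ p ∈ n.divisorsAntidiagonal,
            (divisorCountK 3 p.1 : ℝ) * ((p.2.divisors.card : ℝ)) ^ 2 * A.a (p.1 * p.2) ≤
              ((n.divisors.card : ℝ)) ^ 4 * A.a n := by
          intro p hp
          obtain ⟨hpn, -⟩ := Nat.mem_divisorsAntidiagonal.mp hp
          have h1 : (p.1.divisors.card : ℝ) ≤ (n.divisors.card : ℝ) := by
            exact_mod_cast Finset.card_le_card (Nat.divisors_subset_of_dvd hn0 ⟨p.2, hpn.symm⟩)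
          have h2 : (p.2.divisors.card : ℝ) ≤ (n.divisors.card : ℝ) := by
            exact_mod_cast Finset.card_le_card
              (Nat.divisors_subset_of_dvd hn0 ⟨p.1, by rw [mul_comm]; exact hpn.symm⟩)
          have h3 : (divisorCountK 3 p.1 : ℝ) ≤ ((n.divisors.card : ℝ)) ^ 2 :=
            (divisorCountK_three_le_card_divisors_sq p.1).trans (pow_le_pow_left₀ (Nat.cast_nonneg _) h1 2)
          rw [hpn]
          calc (divisorCountK 3 p.1 : ℝ) * ((p.2.divisors.card : ℝ)) ^ 2 * A.a n
              ≤ ((n.divisors.card : ℝ)) ^ 2 * ((n.divisors.card : ℝ)) ^ 2 * A.a n := by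
                gcongr
                exact A.a_nonneg n
            _ = ((n.divisors.card : ℝ)) ^ 4 * A.a n := by ring
        calc ∑ p ∈ n.divisorsAntidiagonal,
              (divisorCountK 3 p.1 : ℝ) * ((p.2.divisors.card : ℝ)) ^ 2 * A.a (p.1 * p.2)
            ≤ ∑ _p ∈ n.divisorsAntidiagonal, ((n.divisors.card : ℝ)) ^ 4 * A.a n :=
              Finset.sum_le_sum hterm
          _ = (n.divisorsAntidiagonal.card : ℝ) * (((n.divisors.card : ℝ)) ^ 4 * A.a n) := by
              rw [Finset.sum_const, nsmul_eq_mul]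
          _ = A.a n * ((n.divisors.card : ℝ)) ^ 5 := by
              rw [← Nat.map_div_right_divisors, Finset.card_map]
              ring
          _ ≤ A.a n * ((n.divisors.card : ℝ)) ^ 6 :=
              mul_le_mul_of_nonneg_left (pow_le_pow_right₀ hτ1 (by norm_num)) (A.a_nonneg n)

/-! ### Reindexing `ℓ' = ℓ n₁`: from `τ₃(ℓ)` to `6^{ω(ℓ')}` -/

/-- **Reindexing by `ℓ' = ℓ n₁`** (FI §10 p. 1065, "change variables … `w → wn₁` getting
`∑_m τ₃(m)|…|`"; here the outer weight `τ₃` of (7.1) becomes `τ₄ ≤ 6^{ω}`): for `J ≥ 0` vanishing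
off the squarefree integers and any side condition `Q`,
`∑_{ℓ≤X} τ₃(ℓ) ∑_{n₁ ≤ X/ℓ, Q(n₁)} J(ℓ n₁) ≤ ∑_{ℓ'≤X} 6^{ω(ℓ')} J(ℓ')` (`∑_{ℓ∣ℓ'} τ₃(ℓ) = τ₄(ℓ') = 4^{ω(ℓ')}`
on squarefree `ℓ'`). [cite: FriedlanderIwaniecASP1998, §10 p. 1065] -/
theorem sum_tau3_sum_mul_le {J : ℕ → ℝ} (hJ0 : ∀ ℓ, 0 ≤ J ℓ)
    (hJsq : ∀ ℓ, ¬Squarefree ℓ → J ℓ = 0) (X : ℕ) (Q : ℕ → Prop) [DecidablePred Q] :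
    ∑ ℓ ∈ Icc 1 X, (divisorCountK 3 ℓ : ℝ) * ∑ n₁ ∈ (Icc 1 (X / ℓ)).filter Q, J (ℓ * n₁) ≤
      ∑ ℓ' ∈ Icc 1 X, (6 : ℝ) ^ ℓ'.primeFactors.card * J ℓ' := by
  classical
  calc ∑ ℓ ∈ Icc 1 X, (divisorCountK 3 ℓ : ℝ) * ∑ n₁ ∈ (Icc 1 (X / ℓ)).filter Q, J (ℓ * n₁)
      ≤ ∑ ℓ ∈ Icc 1 X, ∑ n₁ ∈ Icc 1 (X / ℓ), (divisorCountK 3 ℓ : ℝ) * J (ℓ * n₁) := by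
        refine Finset.sum_le_sum fun ℓ _ => ?_
        rw [Finset.mul_sum]
        exact Finset.sum_le_sum_of_subset_of_nonneg (Finset.filter_subset _ _) fun n₁ _ _ =>
          mul_nonneg (Nat.cast_nonneg _) (hJ0 _)
    _ ≤ ∑ ℓ' ∈ Ioc 0 X, ∑ p ∈ ℓ'.divisorsAntidiagonal, (divisorCountK 3 p.1 : ℝ) * J (p.1 * p.2) := by
        refine sum_sum_le_sum_divisorsAntidiagonal (f := fun ℓ n₁ => (divisorCountK 3 ℓ : ℝ) * J (ℓ * n₁))
          (fun ℓ n₁ => mul_nonneg (Nat.cast_nonneg _) (hJ0 _)) X (Icc 1 X) (fun ℓ => Icc 1 (X / ℓ))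
          fun ℓ hℓ n₁ hn₁ => ?_
        obtain ⟨hℓ1, -⟩ := Finset.mem_Icc.mp hℓ
        obtain ⟨hn1, hnX⟩ := Finset.mem_Icc.mp hn₁
        refine ⟨hℓ1, hn1, ?_⟩
        have := (Nat.le_div_iff_mul_le hℓ1).mp hnX
        rw [mul_comm] at this
        exact this
    _ ≤ ∑ ℓ' ∈ Ioc 0 X, (6 : ℝ) ^ ℓ'.primeFactors.card * J ℓ' := by
        refine Finset.sum_le_sum fun ℓ' _ => ?_
        have heq : ∑ p ∈ ℓ'.divisorsAntidiagonal, (divisorCountK 3 p.1 : ℝ) * J (p.1 * p.2) =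
            (∑ p ∈ ℓ'.divisorsAntidiagonal, (divisorCountK 3 p.1 : ℝ)) * J ℓ' := by
          rw [Finset.sum_mul]
          refine Finset.sum_congr rfl fun p hp => ?_
          rw [(Nat.mem_divisorsAntidiagonal.mp hp).1]
        rw [heq]
        by_cases hsq : Squarefree ℓ'
        · refine mul_le_mul_of_nonneg_right ?_ (hJ0 ℓ')
          have h4 : ∑ p ∈ ℓ'.divisorsAntidiagonal, (divisorCountK 3 p.1 : ℝ) = (divisorCountK 4 ℓ' : ℝ) := by
            rw [Nat.sum_divisorsAntidiagonal (fun a _b => (divisorCountK 3 a : ℝ)),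
              show (4 : ℕ) = 3 + 1 from rfl, divisorCountK_succ_apply, Nat.cast_sum]
          rw [h4, divisorCountK_apply_of_squarefree 4 hsq, ← card_primeFactors_eq_cardDistinctFactors]
          push_cast
          exact pow_le_pow_left₀ (by norm_num) (by norm_num) _
        · rw [hJsq ℓ' hsq, mul_zero, mul_zero]
    _ = ∑ ℓ' ∈ Icc 1 X, (6 : ℝ) ^ ℓ'.primeFactors.card * J ℓ' := by
        rw [show Ioc 0 X = Icc 1 X from (Finset.Icc_succ_left_eq_Ioc 0 X).symm]

/-! ### The change of variables `u = y/ν` on a general interval -/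

/-- `∫_a^b h(y/ν) dy/y = ∫_{a/ν}^{b/ν} h(u) du/u ≤ ∫_{a/L}^{b} h(u) du/u` for `1 ≤ ν ≤ L`, `0 < a ≤ b` and a
nonnegative bounded measurable `h` (the tree's `intervalIntegral_comp_div_le` is the case
`[a, b] = [Y, eY]`). [cite: FriedlanderIwaniecASP1998, §10 p. 1065] -/
theorem intervalIntegral_comp_div_le_gen {h : ℝ → ℝ} (hm : Measurable h) (h0 : ∀ u, 0 ≤ h u) {M : ℝ}
    (hM : ∀ u, h u ≤ M) {a b L ν : ℝ} (ha : 0 < a) (hab : a ≤ b) (hν : 1 ≤ ν) (hνL : ν ≤ L) :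
    ∫ y in a..b, h (y / ν) / y ≤ ∫ u in (a / L)..b, h u / u := by
  have hν0 : 0 < ν := by linarith
  have hL0 : 0 < L := by linarith
  have hM0 : 0 ≤ M := (h0 0).trans (hM 0)
  have hcv : ∫ y in a..b, h (y / ν) / y = ∫ u in (a / ν)..(b / ν), h u / u := by
    have hfun : (fun y : ℝ => h (y / ν) / y) = fun y => ν⁻¹ * ((fun u : ℝ => h u / u) (y / ν)) := by
      ext y
      simp only
      rw [div_div_eq_mul_div, mul_div_assoc', mul_comm (h (y / ν)) ν, inv_mul_cancel_left₀ hν0.ne']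
    rw [hfun, intervalIntegral.integral_const_mul,
      intervalIntegral.integral_comp_div (fun u : ℝ => h u / u) hν0.ne', smul_eq_mul,
      inv_mul_cancel_left₀ hν0.ne']
  rw [hcv]
  have hca : a / L ≤ a / ν := div_le_div_of_nonneg_left ha.le hν0 hνL
  have hab' : a / ν ≤ b / ν := div_le_div_of_nonneg_right hab hν0.le
  have hbd : b / ν ≤ b := div_le_self (ha.le.trans hab) hν
  have haL : 0 < a / L := div_pos ha hL0
  refine intervalIntegral.integral_mono_interval hca hab' hbd ?_ ?_
  · refine MeasureTheory.ae_restrict_of_forall_mem measurableSet_Ioc fun u hu => ?_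
    exact div_nonneg (h0 u) (haL.le.trans hu.1.le)
  · refine intervalIntegrable_of_abs_le (f := fun u : ℝ => h u / u)
      (hm.div measurable_id : Measurable fun u : ℝ => h u / u) (M := M / (a / L)) fun u hu => ?_
    rw [Set.uIoc_of_le (hca.trans (hab'.trans hbd))] at hu
    have hu0 : 0 < u := haL.trans hu.1
    rw [abs_of_nonneg (div_nonneg (h0 u) hu0.le)]
    calc h u / u ≤ M / u := div_le_div_of_nonneg_right (hM u) hu0.le
      _ ≤ M / (a / L) := div_le_div_of_nonneg_left hM0 haL hu.1.le

/-! ### The rough inner sums `Ψ*` on the dyadic pieces -/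

variable {A : SieveSequence} in
/-- **Dyadic pieces of the rough inner sum of (7.1)** (FI §7: (B′) on the pieces of `(u, su]`; §10:
"the restriction `(n, Π) = 1` only helps matters"): for `ℓ ≥ 1`, `u, x ≥ 0`, under (1.16),
`|∑_{n₀ ≤ x/ℓ rough, v<n₀≤2^{k₀}v} μ(n₀) a_{n₀ℓ}| ≤ ∑_{i<k₀} |∑_{2^iv<n≤2^{i+1}v, ℓn≤x, n rough}
γ(n;1) μ(ℓn) a_{ℓn}|`. [cite: FriedlanderIwaniecASP1998, §10 p. 1065] -/
theorem abs_rough_innerS2_le_sum_pieces (h116 : ∀ n : ℕ, ¬Squarefree n → A.a n = 0) (P : ℝ)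
    {x : ℝ} (hx : 0 ≤ x) {v : ℝ} (hv : 0 ≤ v) (k₀ : ℕ) {ℓ : ℕ} (hℓ : 1 ≤ ℓ) :
    |∑ n₀ ∈ (Icc 1 (⌊x⌋₊ / ℓ)).filter (fun n : ℕ => ∀ p ∈ n.primeFactors, P ≤ (p : ℝ)),
        (if v < (n₀ : ℝ) ∧ (n₀ : ℝ) ≤ 2 ^ k₀ * v then (μ n₀ : ℝ) * A.a (n₀ * ℓ) else 0)| ≤
      ∑ i ∈ range k₀, |∑ n ∈ (Ioc ⌊2 ^ i * v⌋₊ ⌊2 * (2 ^ i * v)⌋₊).filter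
          (fun n : ℕ => ((ℓ * n : ℕ) : ℝ) ≤ x ∧ ∀ p ∈ n.primeFactors, P ≤ (p : ℝ)),
        (SieveSequence.fiGamma 1 n : ℝ) * (μ (ℓ * n) : ℝ) * A.a (ℓ * n)| := by
  classical
  set c : ℕ → ℝ := fun n => if (∀ p ∈ n.primeFactors, P ≤ (p : ℝ)) then
      (μ n : ℝ) * A.a (n * ℓ) else 0 with hc
  have h1 : ∑ n₀ ∈ (Icc 1 (⌊x⌋₊ / ℓ)).filter (fun n : ℕ => ∀ p ∈ n.primeFactors, P ≤ (p : ℝ)),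
        (if v < (n₀ : ℝ) ∧ (n₀ : ℝ) ≤ 2 ^ k₀ * v then (μ n₀ : ℝ) * A.a (n₀ * ℓ) else 0) =
      ∑ n₀ ∈ Icc 1 (⌊x⌋₊ / ℓ), (if v < (n₀ : ℝ) ∧ (n₀ : ℝ) ≤ 2 ^ k₀ * v then c n₀ else 0) := by
    rw [Finset.sum_filter]
    refine Finset.sum_congr rfl fun n₀ _ => ?_
    simp only [hc]
    split_ifs <;> rfl
  rw [h1, sum_ite_Ioc_pow_eq_sum_range c hv k₀ hx hℓ]
  refine (Finset.abs_sum_le_sum_abs _ _).trans (Finset.sum_le_sum fun i _ => ?_)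
  have h2 : ∑ n ∈ (Ioc ⌊2 ^ i * v⌋₊ ⌊2 * (2 ^ i * v)⌋₊).filter (fun n : ℕ => ((ℓ * n : ℕ) : ℝ) ≤ x), c n =
      ∑ n ∈ (Ioc ⌊2 ^ i * v⌋₊ ⌊2 * (2 ^ i * v)⌋₊).filter
          (fun n : ℕ => ((ℓ * n : ℕ) : ℝ) ≤ x ∧ ∀ p ∈ n.primeFactors, P ≤ (p : ℝ)),
        (μ n : ℝ) * A.a (n * ℓ) := by
    symm
    rw [← Finset.filter_filter, Finset.sum_filter]
  have hS : ∀ n ∈ (Ioc ⌊2 ^ i * v⌋₊ ⌊2 * (2 ^ i * v)⌋₊).filter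
      (fun n : ℕ => ((ℓ * n : ℕ) : ℝ) ≤ x ∧ ∀ p ∈ n.primeFactors, P ≤ (p : ℝ)), n ≠ 0 := by
    intro n hn
    have := (Finset.mem_Ioc.mp (Finset.mem_filter.mp hn).1).1
    omega
  rw [h2, sum_moebius_mul_a_eq h116 ℓ _ hS, abs_mul]
  have hμ : |(μ ℓ : ℝ)| ≤ 1 := by exact_mod_cast ArithmeticFunction.abs_moebius_le_one
  calc |(μ ℓ : ℝ)| * _ ≤ 1 * _ := mul_le_mul_of_nonneg_right hμ (abs_nonneg _)
    _ = _ := one_mul _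

variable {A : SieveSequence} in
/-- **The reduced sieved bilinear bound on the pieces (case `γ = 1`)**: if every dyadic piece
`N = 2^i v`, `i < k₀`, satisfies `∑_ℓ 6^{ω(ℓ)} |∑_{N<n≤2N, ℓn≤x, n rough} γ(n;1) μ(ℓn) a_{ℓn}| ≤ K_B`, then
`∑_{ℓ≤x} 6^{ω(ℓ)} |∑_{n₀≤x/ℓ rough, v<n₀≤2^{k₀}v} μ(n₀) a_{n₀ℓ}| ≤ k₀ K_B`. [cite: FriedlanderIwaniecASP1998, §10 (10.5)] -/
theorem sum_six_pow_abs_rough_innerS2_le (h116 : ∀ n : ℕ, ¬Squarefree n → A.a n = 0) (P : ℝ)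
    {x : ℝ} (hx : 0 ≤ x) {v : ℝ} (hv : 0 ≤ v) (k₀ : ℕ) {KB : ℝ}
    (hB : ∀ i ∈ range k₀, ∑ m ∈ Icc 1 ⌊x⌋₊, (6 : ℝ) ^ m.primeFactors.card *
      |∑ n ∈ (Ioc ⌊2 ^ i * v⌋₊ ⌊2 * (2 ^ i * v)⌋₊).filter
          (fun n : ℕ => ((m * n : ℕ) : ℝ) ≤ x ∧ ∀ p ∈ n.primeFactors, P ≤ (p : ℝ)),
        (SieveSequence.fiGamma 1 n : ℝ) * (μ (m * n) : ℝ) * A.a (m * n)| ≤ KB) :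
    ∑ ℓ ∈ Icc 1 ⌊x⌋₊, (6 : ℝ) ^ ℓ.primeFactors.card *
        |∑ n₀ ∈ (Icc 1 (⌊x⌋₊ / ℓ)).filter (fun n : ℕ => ∀ p ∈ n.primeFactors, P ≤ (p : ℝ)),
          (if v < (n₀ : ℝ) ∧ (n₀ : ℝ) ≤ 2 ^ k₀ * v then (μ n₀ : ℝ) * A.a (n₀ * ℓ) else 0)| ≤ k₀ * KB := by
  classical
  set T : ℕ → ℕ → ℝ := fun i m =>
    |∑ n ∈ (Ioc ⌊2 ^ i * v⌋₊ ⌊2 * (2 ^ i * v)⌋₊).filter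
        (fun n : ℕ => ((m * n : ℕ) : ℝ) ≤ x ∧ ∀ p ∈ n.primeFactors, P ≤ (p : ℝ)),
      (SieveSequence.fiGamma 1 n : ℝ) * (μ (m * n) : ℝ) * A.a (m * n)| with hT
  calc ∑ ℓ ∈ Icc 1 ⌊x⌋₊, (6 : ℝ) ^ ℓ.primeFactors.card *
        |∑ n₀ ∈ (Icc 1 (⌊x⌋₊ / ℓ)).filter (fun n : ℕ => ∀ p ∈ n.primeFactors, P ≤ (p : ℝ)),
          (if v < (n₀ : ℝ) ∧ (n₀ : ℝ) ≤ 2 ^ k₀ * v then (μ n₀ : ℝ) * A.a (n₀ * ℓ) else 0)|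
      ≤ ∑ ℓ ∈ Icc 1 ⌊x⌋₊, (6 : ℝ) ^ ℓ.primeFactors.card * ∑ i ∈ range k₀, T i ℓ := by
        refine Finset.sum_le_sum fun ℓ hℓ => ?_
        exact mul_le_mul_of_nonneg_left
          (abs_rough_innerS2_le_sum_pieces h116 P hx hv k₀ (Finset.mem_Icc.mp hℓ).1) (by positivity)
    _ = ∑ i ∈ range k₀, ∑ ℓ ∈ Icc 1 ⌊x⌋₊, (6 : ℝ) ^ ℓ.primeFactors.card * T i ℓ := by
        rw [Finset.sum_comm]
        exact Finset.sum_congr rfl fun ℓ _ => by rw [Finset.mul_sum]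
    _ ≤ ∑ i ∈ range k₀, KB := Finset.sum_le_sum fun i hi => hB i hi
    _ = k₀ * KB := by rw [Finset.sum_const, Finset.card_range, nsmul_eq_mul]

/-! ### Assembly: (7.2) under (B*) -/

set_option maxHeartbeats 400000 in -- the assembly carries the context of `…S2` plus the `W₀/W₁` data
/-- **FI (7.2) under (B*) with an implied constant**: `S₂(x; Y, z) ≪ A(x)(log x)⁻¹` in the rough
regime with the clauses unbundled — the core clauses `FIAsymptoticSieveHypothesesCore A D`, the
parameter clause (10.2) for `δ = (log x)^α`, `Δ_B = x^{2θ}`, `P`, upper-bound sieve weights of sifting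
range `x^{θ₁}` and level `x^{θ/2}` (`0 < θ₁ ≤ θ/2`, `θ < 1/6`), and (B*) with a CONSTANT `K_B*`,
`∑_m |∑*…| ≤ K_B* A(x)(log x)^{-2^{26}}` (the print, p. 1063, has "`≪`"; FI's Theorem 2, §9, needs the
constant since (B*) for `ã = μ²a` is normalised by `Ã(x) = G A(x)(1 + o(1))`, `G < 1`; the bundled
`FIRegimeRough` is the case `K_B* = 1`, `fi_asp_S2_estimate_rough_holds` below). FI §10: "In the case
of `S₂` we note that (7.1) contains such an integration with `y` in place of `w` and `γ(n;t) = 1`".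
The proof is the tree's `fi_asp_S2_estimate_holds` (`…S2`) up to (7.1) (steps (A)–(D):
`|S₂(x;Y,z)| ≤ (log x) ∫_{Y/Δ}^{eY} ∑_ℓ τ₃(ℓ)|Ψ(ℓ,u)| du/u`), after which the pointwise (B′) is
replaced by §10: `Ψ(ℓ,u)` is split at the smooth part `n₁` of `b` (`abs_Psi_le_smooth_add_large`); the
terms `n₁ > Δ` are `≤ Δ^{-1/log P} ∑ a_n τ(n)⁶ ≤ C₆ A(x)(log x)^{-7}`
(`sum_large_smooth_le_rankin_one`, `sum_tau3_sum_tau_sq_le`, `rankin_rpow_le_log_rpow`, the sixth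
moment); the terms `n₁ ≤ Δ` are integrated once more, `u → u n₁` (`intervalIntegral_comp_div_le_gen`,
down to `Y/Δ² = x^{-3θ/2}√D`, inside the range of (B*) for `Δ_B = x^{2θ}`), reindexed `ℓ' = ℓn₁` with
weight `τ₄ ≤ 6^{ω}` (`sum_tau3_sum_mul_le`) and bounded on the dyadic pieces by the reduced sieved
bilinear bound `FIAsymptoticSieveHypothesesCore.reduced_rough_bilinear_bound_six_of_bilinear`
(`…RoughK`; the constant `K_B*` is cleared by one power of `log x`) at `C = 1`
(`sum_six_pow_abs_rough_innerS2_le`): `|S₂(x; Y, z)| ≤ (12K_B + 2C₆) A(x)/log x`.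
[cite: FriedlanderIwaniecASP1998, §7 (7.2) and §10 Theorem 3] -/
theorem fi_asp_S2_estimate_roughK (A : SieveSequence) (D : ℝ → ℝ) (α θ θ₁ : ℝ)
    (lam : ℝ → ℕ → ℤ) (P : ℝ → ℝ) {KBst : ℝ} (hα : 0 < α) (hθ₁ : 0 < θ₁) (hθ₁le : θ₁ ≤ θ / 2)
    (hθ6 : θ < 1 / 6) (hcore : A.FIAsymptoticSieveHypothesesCore D)
    (hparams : ∀ᶠ x : ℝ in atTop, 2 ≤ Real.log x ^ α ∧ 2 ≤ x ^ (2 * θ) ∧ 2 ≤ P x ∧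
      P x ≤ (x ^ (2 * θ)) ^ (1 / (2 ^ 35 * Real.log (Real.log x))))
    (hB : ∀ᶠ x : ℝ in atTop, ∀ N : ℝ, Real.sqrt (D x) / x ^ (2 * θ) < N →
      N < Real.sqrt x / Real.log x ^ α → ∀ C : ℝ, 1 ≤ C → C ≤ x / D x →
        A.fiBilinearRough x N C (P x) ≤ KBst * A.size x / Real.log x ^ (2 ^ 26 : ℕ))
    (hweights : ∀ᶠ x : ℝ in atTop, IsUpperSieveWeights (x ^ θ₁) (x ^ (θ / 2)) (lam x)) :
    ∃ K : ℝ, ∀ᶠ x : ℝ in atTop, ∀ s : ℝ, IsFISplit D α θ x s →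
      ∀ z : ℝ, fiY D θ x ≤ z → z ≤ Real.exp 1 * fiY D θ x →
        |A.fiS2Y (lam x) s x (fiY D θ x) z| ≤ K * A.size x / Real.log x := by
  classical
  have hhyp := hcore.withTrivialBilinear
  have h116 : ∀ n : ℕ, ¬Squarefree n → A.a n = 0 := hhyp.2.2.2.2.2.1
  obtain ⟨KB, hKB⟩ := hcore.reduced_rough_bilinear_bound_six_of_bilinear
    (δ := fun x => Real.log x ^ α) (Δ := fun x => x ^ (2 * θ)) (P := P) hB (k := 5) (by norm_num)
  obtain ⟨K₆, h16c⟩ := hcore.2.2.1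
  have hθ : 0 < θ := by linarith
  have hθ3 : θ < 1 / 3 := by linarith
  set K₀ := max KB 0 with hK₀
  have hK₀0 : 0 ≤ K₀ := le_max_right _ _
  have hKBK₀ : KB ≤ K₀ := le_max_left _ _
  set C6 : ℝ := 2 ^ 18 * max K₆ 0 * Real.exp (2 ^ 28) with hC6
  have hC60 : 0 ≤ C6 := by positivity
  refine ⟨12 * K₀ + 2 * C6, ?_⟩
  have hR1 : ∀ᶠ x : ℝ in atTop, x ^ (2 / 3 : ℝ) < D x ∧ D x < x :=
    hhyp.2.2.2.2.2.2.1.mono fun x hx => ⟨hx.1, hx.2.1⟩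
  have hllev : ∀ᶠ x : ℝ in atTop, 0 < Real.log (Real.log x) :=
    ((Real.tendsto_log_atTop.comp Real.tendsto_log_atTop).eventually_gt_atTop 0).mono fun x hx => hx
  filter_upwards [hweights, hKB, hR1, eventually_ge_atTop (Real.exp 1), h16c, hparams, hllev,
    eventually_ge_atTop (16 : ℝ)] with x hw hBx hR1x hxe h16x hparx hll hx16
  intro s hs z _hYz _hzY
  -- basics at `x`
  have he1 : (1 : ℝ) ≤ Real.exp 1 := by linarith [Real.add_one_le_exp (1 : ℝ)]
  have hx1 : 1 ≤ x := he1.trans hxe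
  have hx1' : 1 < x := by linarith only [hx16]
  have hx0 : 0 < x := by linarith
  have hlogx : 1 ≤ Real.log x := by rw [Real.le_log_iff_exp_le hx0]; exact hxe
  have hlogx0 : 0 < Real.log x := by linarith
  have hD1 : 1 ≤ D x := le_trans (Real.one_le_rpow hx1 (by norm_num)) hR1x.1.le
  have hD0 : 0 < D x := by linarith
  have hDx : D x < x := hR1x.2
  have hxD1 : (1 : ℝ) ≤ x / D x := (one_le_div hD0).mpr hDx.le
  have hA0 : 0 ≤ A.size x := by rw [hhyp.size_eq]; exact A.congrSum_nonneg 1 x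
  set L := x ^ (θ / 2) with hLdef
  have hL1 : 1 ≤ L := Real.one_le_rpow hx1 (by linarith)
  have hL0 : 0 < L := by linarith
  have hLx : L ≤ x := by
    calc L = x ^ (θ / 2) := rfl
      _ ≤ x ^ (1 : ℝ) := Real.rpow_le_rpow_of_exponent_le hx1 (by linarith)
      _ = x := Real.rpow_one x
  have hxθ0 : x ^ (θ / 2) ≠ 0 := hL0.ne'
  have hsD0 : Real.sqrt (D x) ≠ 0 := (Real.sqrt_pos.mpr hD0).ne'
  have hlα1 : 1 ≤ Real.log x ^ α := Real.one_le_rpow hlogx hα.le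
  have hlα0 : Real.log x ^ α ≠ 0 := by positivity
  set Y := fiY D θ x with hYdef
  obtain ⟨hY0, -⟩ :=
    fiY_pos_and_ge (D := D) (θ := θ) (θ₁ := 1 / 3 - θ / 2) hx1 hR1x.1 le_rfl
  have hYe : Y ≤ Real.exp 1 * Y := le_mul_of_one_le_left hY0.le he1
  have hYL0 : 0 < Y / L := div_pos hY0 hL0
  have hYLe : Y / L ≤ Real.exp 1 * Y := (div_le_self hY0.le hL1).trans hYe
  have hYL_eq : Y / L = Real.sqrt (D x) / x ^ θ := by
    show fiY D θ x / x ^ (θ / 2) = Real.sqrt (D x) / x ^ θ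
    rw [fiY, div_div, ← Real.rpow_add hx0, add_halves]
  have hSY : fiSLow D α θ x * Y = Real.sqrt x / (8 * Real.log x ^ α) := by
    show fiSLow D α θ x * fiY D θ x = Real.sqrt x / (8 * Real.log x ^ α)
    have hb : 8 * Real.log x ^ α * Real.sqrt (D x) * x ^ (θ / 2) ≠ 0 :=
      mul_ne_zero (mul_ne_zero (mul_ne_zero (by norm_num) hlα0) hsD0) hxθ0
    have hd : (8 * Real.log x ^ α) ≠ 0 := mul_ne_zero (by norm_num) hlα0
    rw [fiSLow, fiY, div_mul_div_comm, div_eq_div_iff hb hd]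
    ring
  have hfiSLow_le : fiSLow D α θ x ≤ x ^ 2 / 8 := by
    unfold fiSLow
    rw [div_le_div_iff₀ (by positivity) (by norm_num : (0 : ℝ) < 8)]
    have h2 : Real.sqrt x ≤ x := Real.sqrt_le_self_iff.mpr (Or.inr hx1)
    have h4 : 1 ≤ Real.sqrt (D x) := Real.one_le_sqrt.mpr hD1
    have hsx0 : 0 ≤ Real.sqrt x := Real.sqrt_nonneg x
    calc x ^ (θ / 2) * Real.sqrt x * 8 ≤ x * x * (8 * 1 * 1) := by
          nlinarith [mul_le_mul hLx h2 hsx0 hx0.le]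
      _ ≤ x ^ 2 * (8 * Real.log x ^ α * Real.sqrt (D x)) := by
          rw [sq]
          gcongr
  -- the splitting parameter `s = 2^{k₀}`
  obtain ⟨⟨k₀, rfl⟩, _hslow, hsup⟩ := hs
  have hk₀ : (k₀ : ℝ) ≤ 4 * Real.log x := by
    refine nat_le_four_mul_log_of_two_pow_le ?_
    nlinarith [hsup, hfiSLow_le]
  set X := ⌊x⌋₊ with hXdef
  -- the inner sums `Ψ(ℓ, u) = ∑_{b ≤ X/ℓ, u < b ≤ su} μ(b) a_{bℓ}`
  set Ψ : ℕ → ℝ → ℝ := fun ℓ u => ∑ b ∈ Icc 1 (X / ℓ),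
      (if u < (b : ℝ) ∧ (b : ℝ) ≤ 2 ^ k₀ * u then (μ b : ℝ) * A.a (b * ℓ) else 0) with hΨdef
  have hΨm : ∀ ℓ, Measurable (Ψ ℓ) := fun ℓ => A.measurable_innerS2 X ℓ (2 ^ k₀)
  have hΨb : ∀ ℓ u, |Ψ ℓ u| ≤ ∑ b ∈ Icc 1 (X / ℓ), A.a (b * ℓ) := fun ℓ u =>
    A.abs_innerS2_le X ℓ (2 ^ k₀) u
  have hΨam : ∀ ℓ, Measurable fun u => |Ψ ℓ u| := fun ℓ => continuous_abs.measurable.comp (hΨm ℓ)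
  have hΨab : ∀ ℓ u, |(fun u => |Ψ ℓ u|) u| ≤ ∑ b ∈ Icc 1 (X / ℓ), A.a (b * ℓ) := fun ℓ u => by
    simpa only [abs_abs] using hΨb ℓ u
  have hJX : ∀ ℓ, X < ℓ → ∀ u, |Ψ ℓ u| = 0 := by
    intro ℓ hℓ u
    have hI : Icc 1 (X / ℓ) = ∅ := by
      rw [Nat.div_eq_of_lt hℓ]
      exact Finset.Icc_eq_empty_of_lt zero_lt_one
    simp only [hΨdef, hI, Finset.sum_empty, abs_zero]
  -- integrability of the pieces
  have hpiece : ∀ (ℓ : ℕ) (ν : ℝ) {a b : ℝ}, 0 < a → a ≤ b →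
      IntervalIntegrable (fun y => |Ψ ℓ (y / ν)| / y) volume a b := fun ℓ ν a b ha hab =>
    intervalIntegrable_comp_div_div (h := fun u => |Ψ ℓ u|) (hΨam ℓ) (hΨab ℓ) ν ha hab
  have hpiece1 : ∀ (ℓ : ℕ) {a b : ℝ}, 0 < a → a ≤ b →
      IntervalIntegrable (fun u => |Ψ ℓ u| / u) volume a b := fun ℓ a b ha hab => by
    simpa only [div_one] using hpiece ℓ 1 ha hab
  -- the weights `c_k = (log x) τ(k)` and the constants
  set c : ℕ → ℝ := fun k => Real.log x * (k.divisors.card : ℝ) with hcdef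
  have hc0 : ∀ k, 0 ≤ c k := fun k => mul_nonneg hlogx0.le (Nat.cast_nonneg _)
  set KB' : ℝ := K₀ * A.size x / Real.log x ^ 5 with hKB'
  have hKB'0 : 0 ≤ KB' := by positivity
  set M₀ : ℝ := k₀ * KB' with hM₀
  -- the reduced sieved bilinear bound on the dyadic pieces, for `v ∈ (Y/Δ², eY)`, `C = 1`
  have hYLL0 : 0 < Y / L / L := div_pos hYL0 hL0
  have hB6' : ∀ v ∈ Set.Ioo (Y / L / L) (Real.exp 1 * Y), ∀ i ∈ range k₀,
      ∑ m ∈ Icc 1 ⌊x⌋₊, (6 : ℝ) ^ m.primeFactors.card *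
        |∑ n ∈ (Ioc ⌊2 ^ i * v⌋₊ ⌊2 * (2 ^ i * v)⌋₊).filter
            (fun n : ℕ => ((m * n : ℕ) : ℝ) ≤ x ∧ ∀ p ∈ n.primeFactors, P x ≤ (p : ℝ)),
          (SieveSequence.fiGamma 1 n : ℝ) * (μ (m * n) : ℝ) * A.a (m * n)| ≤ KB' := by
    intro v hv i hi
    have hi' : i < k₀ := Finset.mem_range.mp hi
    have hv0 : 0 < v := hYLL0.trans hv.1
    have hN1 : Real.sqrt (D x) / x ^ (2 * θ) < 2 ^ i * v := by
      have hle : Real.sqrt (D x) / x ^ (2 * θ) ≤ Y / L / L := by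
        rw [hYL_eq, div_div, ← Real.rpow_add hx0]
        refine div_le_div_of_nonneg_left (Real.sqrt_nonneg _) (Real.rpow_pos_of_pos hx0 _) ?_
        exact Real.rpow_le_rpow_of_exponent_le hx1 (by linarith only [hθ])
      calc Real.sqrt (D x) / x ^ (2 * θ) ≤ Y / L / L := hle
        _ < v := hv.1
        _ ≤ 2 ^ i * v := le_mul_of_one_le_left hv0.le (one_le_pow₀ one_le_two)
    have h2i : (2 : ℝ) ^ i ≤ 2 ^ k₀ / 2 := by
      rw [le_div_iff₀ two_pos, ← pow_succ]
      exact pow_le_pow_right₀ one_le_two (Nat.succ_le_of_lt hi')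
    have hq : 0 < Real.sqrt x / Real.log x ^ α := div_pos (Real.sqrt_pos.mpr hx0) (by positivity)
    have he8 : Real.exp 1 / 8 < 1 := by have := Real.exp_one_lt_d9; linarith
    have hN2 : 2 ^ i * v < Real.sqrt x / Real.log x ^ α := by
      calc 2 ^ i * v ≤ 2 ^ i * (Real.exp 1 * Y) := mul_le_mul_of_nonneg_left hv.2.le (by positivity)
        _ ≤ (2 ^ k₀ / 2) * (Real.exp 1 * Y) := mul_le_mul_of_nonneg_right h2i (by positivity)
        _ ≤ fiSLow D α θ x * (Real.exp 1 * Y) :=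
            mul_le_mul_of_nonneg_right (by linarith [hsup]) (by positivity)
        _ = (Real.exp 1 / 8) * (Real.sqrt x / Real.log x ^ α) := by
            rw [show fiSLow D α θ x * (Real.exp 1 * Y) = Real.exp 1 * (fiSLow D α θ x * Y) by ring,
              hSY]
            field_simp
        _ < 1 * (Real.sqrt x / Real.log x ^ α) := mul_lt_mul_of_pos_right he8 hq
        _ = Real.sqrt x / Real.log x ^ α := one_mul _
    have h0 := hBx (2 ^ i * v) hN1 hN2 1 le_rfl hxD1
    refine h0.trans ?_
    rw [hKB']
    exact div_le_div_of_nonneg_right (mul_le_mul_of_nonneg_right hKBK₀ hA0) (by positivity)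
  -- `W₁` (Rankin under (10.2) and the sixth moment): the constant `E6`
  have hPx1 : 1 < P x := by linarith only [hparx.2.2.1]
  set M6 : ℝ := ∑ n ∈ Ioc 0 ⌊x⌋₊, A.a n * ((n.divisors.card : ℝ)) ^ 6 with hM6
  have hM60 : 0 ≤ M6 := Finset.sum_nonneg fun n _ => mul_nonneg (A.a_nonneg n) (by positivity)
  set E6 : ℝ := L ^ (-(1 / Real.log (P x))) * M6 with hE6
  have hrank0 : 0 ≤ L ^ (-(1 / Real.log (P x))) := Real.rpow_nonneg hL0.le _
  have hE60 : 0 ≤ E6 := mul_nonneg hrank0 hM60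
  have hE6le : E6 ≤ C6 * A.size x / Real.log x ^ 7 := by
    have hx8 : (8 : ℝ) ≤ x := by linarith only [hx16]
    have hmom := hhyp.sum_a_mul_card_divisors_pow_six_le hx8 h16x
    have hrank : L ^ (-(1 / Real.log (P x))) ≤ Real.log x ^ (-(2 ^ 33 : ℝ)) := by
      rw [hLdef]; exact rankin_rpow_le_log_rpow hx1' hll hθ hparx.2.2.1 hparx.2.2.2
    have hpow : Real.log x ^ (-(2 ^ 33 : ℝ)) * Real.log x ^ (2 ^ 26 : ℝ) ≤ (Real.log x ^ 7)⁻¹ := by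
      have h7 : (Real.log x ^ 7)⁻¹ = Real.log x ^ (-(7 : ℝ)) := by
        rw [Real.rpow_neg hlogx0.le, show (7 : ℝ) = ((7 : ℕ) : ℝ) by norm_num, Real.rpow_natCast]
      rw [h7, ← Real.rpow_add hlogx0]
      exact Real.rpow_le_rpow_of_exponent_le hlogx (by norm_num)
    calc E6 ≤ Real.log x ^ (-(2 ^ 33 : ℝ)) * (C6 * A.size x * Real.log x ^ (2 ^ 26 : ℝ)) :=
          mul_le_mul hrank hmom hM60 (Real.rpow_nonneg hlogx0.le _)
      _ = C6 * A.size x * (Real.log x ^ (-(2 ^ 33 : ℝ)) * Real.log x ^ (2 ^ 26 : ℝ)) := by ring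
      _ ≤ C6 * A.size x * (Real.log x ^ 7)⁻¹ := mul_le_mul_of_nonneg_left hpow (by positivity)
      _ = C6 * A.size x / Real.log x ^ 7 := by rw [div_eq_mul_inv]
  -- Step (A): `|∫ S₂ dy/y| ≤ ∫ G dy`
  set G : ℝ → ℝ := fun y => ∑ k ∈ Icc 1 X, ∑ ν ∈ Icc 1 ⌊L⌋₊, c k * (|Ψ (ν * k) (y / ν)| / y)
    with hGdef
  have hGalt : ∀ y, G y = (Real.log x * ∑ k ∈ Icc 1 X, (k.divisors.card : ℝ) *
      ∑ ν ∈ Icc 1 ⌊L⌋₊, |Ψ (ν * k) (y / ν)|) / y := by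
    intro y
    simp only [hGdef, hcdef]
    rw [Finset.mul_sum, Finset.sum_div]
    refine Finset.sum_congr rfl fun k _ => ?_
    rw [Finset.mul_sum, Finset.mul_sum, Finset.sum_div]
    refine Finset.sum_congr rfl fun ν _ => ?_
    ring
  have hGint : IntervalIntegrable G volume Y (Real.exp 1 * Y) := by
    refine intervalIntegrable_finset_sum_fun _ fun k _ => ?_
    refine intervalIntegrable_finset_sum_fun _ fun ν _ => ?_
    exact (hpiece (ν * k) ν hY0 hYe).const_mul _
  have hpt : ∀ᵐ y : ℝ, y ∈ Set.Ioc Y (Real.exp 1 * Y) →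
      ‖A.fiS2 (lam x) (2 ^ k₀) x y z / y‖ ≤ G y := by
    refine Filter.Eventually.of_forall fun y hy => ?_
    have hy0 : 0 < y := hY0.trans hy.1
    rw [Real.norm_eq_abs, abs_div, abs_of_pos hy0, hGalt y]
    refine div_le_div_of_nonneg_right ?_ hy0.le
    exact A.abs_fiS2_le h116 hw hL0.le hx1 (2 ^ k₀) y z
  have hA : |A.fiS2Y (lam x) (2 ^ k₀) x Y z| ≤ ∫ y in Y..(Real.exp 1 * Y), G y := by
    have h := intervalIntegral.norm_integral_le_of_norm_le
      (f := fun y => A.fiS2 (lam x) (2 ^ k₀) x y z / y) hYe hpt hGint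
    rw [Real.norm_eq_abs] at h
    simpa only [SieveSequence.fiS2Y, SieveSequence.logAvg] using h
  -- Step (B): push the integral through the finite sums
  have hBeq : ∫ y in Y..(Real.exp 1 * Y), G y =
      ∑ k ∈ Icc 1 X, ∑ ν ∈ Icc 1 ⌊L⌋₊, c k * ∫ y in Y..(Real.exp 1 * Y), |Ψ (ν * k) (y / ν)| / y := by
    simp only [hGdef]
    rw [intervalIntegral.integral_finsetSum (fun k _ =>
      intervalIntegrable_finset_sum_fun _ fun ν _ => (hpiece (ν * k) ν hY0 hYe).const_mul _)]
    refine Finset.sum_congr rfl fun k _ => ?_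
    rw [intervalIntegral.integral_finsetSum (fun ν _ => (hpiece (ν * k) ν hY0 hYe).const_mul _)]
    refine Finset.sum_congr rfl fun ν _ => ?_
    exact intervalIntegral.integral_const_mul _ _
  -- Step (C): the change of variables `u = y/ν₂`, `1 ≤ ν₂ ≤ Δ`
  have hCle : (∑ k ∈ Icc 1 X, ∑ ν ∈ Icc 1 ⌊L⌋₊,
        c k * ∫ y in Y..(Real.exp 1 * Y), |Ψ (ν * k) (y / ν)| / y) ≤
      ∑ k ∈ Icc 1 X, ∑ ν ∈ Icc 1 ⌊L⌋₊,
        c k * ∫ u in (Y / L)..(Real.exp 1 * Y), |Ψ (ν * k) u| / u := by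
    refine Finset.sum_le_sum fun k _ => Finset.sum_le_sum fun ν hν => ?_
    refine mul_le_mul_of_nonneg_left ?_ (hc0 k)
    obtain ⟨hν1, hνL⟩ := Finset.mem_Icc.mp hν
    exact intervalIntegral_comp_div_le (h := fun u => |Ψ (ν * k) u|) (hΨam _)
      (fun u => abs_nonneg _) (fun u => hΨb _ u) hY0 (by exact_mod_cast hν1)
      ((Nat.cast_le.mpr hνL).trans (Nat.floor_le hL0.le))
  -- Step (D): pull the finite sums back inside
  have hDeq : (∑ k ∈ Icc 1 X, ∑ ν ∈ Icc 1 ⌊L⌋₊,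
        c k * ∫ u in (Y / L)..(Real.exp 1 * Y), |Ψ (ν * k) u| / u) =
      ∫ u in (Y / L)..(Real.exp 1 * Y),
        ∑ k ∈ Icc 1 X, ∑ ν ∈ Icc 1 ⌊L⌋₊, c k * (|Ψ (ν * k) u| / u) := by
    rw [intervalIntegral.integral_finsetSum (fun k _ =>
      intervalIntegrable_finset_sum_fun _ fun ν _ => (hpiece1 (ν * k) hYL0 hYLe).const_mul _)]
    refine Finset.sum_congr rfl fun k _ => ?_
    rw [intervalIntegral.integral_finsetSum (fun ν _ => (hpiece1 (ν * k) hYL0 hYLe).const_mul _)]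
    refine Finset.sum_congr rfl fun ν _ => ?_
    exact (intervalIntegral.integral_const_mul _ _).symm
  -- Step (E): the pointwise bound by `τ₃`, then §10: `W₀(u) + W₁`
  set SMle : ℕ → Finset ℕ := fun ℓ => (Icc 1 (X / ℓ)).filter (fun n : ℕ => Squarefree n ∧
      (∀ p ∈ n.primeFactors, (p : ℝ) < P x) ∧ (n : ℝ) ≤ L) with hSMle
  set Ψs : ℕ → ℝ → ℝ := fun ℓ' v => ∑ n₀ ∈ (Icc 1 (X / ℓ')).filter
      (fun n : ℕ => ∀ p ∈ n.primeFactors, P x ≤ (p : ℝ)),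
        (if v < (n₀ : ℝ) ∧ (n₀ : ℝ) ≤ 2 ^ k₀ * v then (μ n₀ : ℝ) * A.a (n₀ * ℓ') else 0) with hΨs
  set F0 : ℝ → ℝ := fun u => ∑ ℓ ∈ Icc 1 X, (divisorCountK 3 ℓ : ℝ) *
      ∑ n₁ ∈ SMle ℓ, |Ψs (ℓ * n₁) (u / n₁)| with hF0
  have hF00 : ∀ u, 0 ≤ F0 u := fun u => Finset.sum_nonneg fun ℓ _ =>
    mul_nonneg (Nat.cast_nonneg _) (Finset.sum_nonneg fun n₁ _ => abs_nonneg _)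
  have hpt2 : ∀ u ∈ Set.Ioo (Y / L) (Real.exp 1 * Y),
      (∑ k ∈ Icc 1 X, ∑ ν ∈ Icc 1 ⌊L⌋₊, c k * (|Ψ (ν * k) u| / u)) ≤
        Real.log x * ((F0 u + E6) * u⁻¹) := by
    intro u hu
    have hu0 : 0 < u := hYL0.trans hu.1
    have hsum1 : (∑ k ∈ Icc 1 X, (k.divisors.card : ℝ) * ∑ ν ∈ Icc 1 ⌊L⌋₊, |Ψ (ν * k) u|) ≤
        ∑ ℓ ∈ Icc 1 X, (divisorCountK 3 ℓ : ℝ) * |Ψ ℓ u| :=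
      sum_card_divisors_mul_sum_le (J := fun ℓ => |Ψ ℓ u|) (fun ℓ => abs_nonneg _)
        (fun ℓ hℓ => hJX ℓ hℓ u) ⌊L⌋₊
    have hsum2 : ∑ ℓ ∈ Icc 1 X, (divisorCountK 3 ℓ : ℝ) * |Ψ ℓ u| ≤ F0 u + E6 := by
      calc ∑ ℓ ∈ Icc 1 X, (divisorCountK 3 ℓ : ℝ) * |Ψ ℓ u|
          ≤ ∑ ℓ ∈ Icc 1 X, (divisorCountK 3 ℓ : ℝ) * ((∑ n₁ ∈ SMle ℓ, |Ψs (ℓ * n₁) (u / n₁)|) +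
              L ^ (-(1 / Real.log (P x))) * ∑ b ∈ Icc 1 (X / ℓ), ((b.divisors.card : ℝ)) ^ 2 * A.a (b * ℓ)) := by
            refine Finset.sum_le_sum fun ℓ _ => mul_le_mul_of_nonneg_left ?_ (Nat.cast_nonneg _)
            exact (abs_Psi_le_smooth_add_large (A := A) (P x) L ℓ X u (2 ^ k₀)).trans
              (add_le_add le_rfl (sum_large_smooth_le_rankin_one h116 hPx1 hL0 ℓ X))
        _ = F0 u + L ^ (-(1 / Real.log (P x))) * ∑ ℓ ∈ Icc 1 X, (divisorCountK 3 ℓ : ℝ) *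
              ∑ b ∈ Icc 1 (X / ℓ), ((b.divisors.card : ℝ)) ^ 2 * A.a (b * ℓ) := by
            rw [hF0, Finset.mul_sum, ← Finset.sum_add_distrib]
            exact Finset.sum_congr rfl fun ℓ _ => by ring
        _ ≤ F0 u + E6 := add_le_add le_rfl (mul_le_mul_of_nonneg_left (sum_tau3_sum_tau_sq_le X) hrank0)
    have heq : (∑ k ∈ Icc 1 X, ∑ ν ∈ Icc 1 ⌊L⌋₊, c k * (|Ψ (ν * k) u| / u)) =
        (Real.log x * u⁻¹) *
          ∑ k ∈ Icc 1 X, (k.divisors.card : ℝ) * ∑ ν ∈ Icc 1 ⌊L⌋₊, |Ψ (ν * k) u| := by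
      rw [Finset.mul_sum]
      refine Finset.sum_congr rfl fun k _ => ?_
      rw [Finset.mul_sum, Finset.mul_sum]
      refine Finset.sum_congr rfl fun ν _ => ?_
      simp only [hcdef]
      rw [div_eq_mul_inv]
      ring
    rw [heq]
    calc Real.log x * u⁻¹ *
          ∑ k ∈ Icc 1 X, (k.divisors.card : ℝ) * ∑ ν ∈ Icc 1 ⌊L⌋₊, |Ψ (ν * k) u|
        ≤ Real.log x * u⁻¹ * (F0 u + E6) :=
          mul_le_mul_of_nonneg_left (hsum1.trans hsum2) (by positivity)
      _ = Real.log x * ((F0 u + E6) * u⁻¹) := by ring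
  -- the integrated `W₀`: `∫_{Y/L}^{eY} F0(u) du/u ≤ k₀ KB' (1 + 2 log L)`
  have hΨsm : ∀ ℓ', Measurable (Ψs ℓ') := fun ℓ' =>
    measurable_window_sum _ (fun n₀ => (μ n₀ : ℝ) * A.a (n₀ * ℓ')) (2 ^ k₀)
  have hΨsam : ∀ ℓ', Measurable fun v => |Ψs ℓ' v| := fun ℓ' => continuous_abs.measurable.comp (hΨsm ℓ')
  have hΨsb : ∀ ℓ' v, |Ψs ℓ' v| ≤ ∑ n₀ ∈ (Icc 1 (X / ℓ')).filter
      (fun n : ℕ => ∀ p ∈ n.primeFactors, P x ≤ (p : ℝ)), |(μ n₀ : ℝ) * A.a (n₀ * ℓ')| := fun ℓ' v =>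
    abs_window_sum_le _ (fun n₀ => (μ n₀ : ℝ) * A.a (n₀ * ℓ')) (2 ^ k₀) v
  have hΨsab : ∀ ℓ' v, |(fun v => |Ψs ℓ' v|) v| ≤ ∑ n₀ ∈ (Icc 1 (X / ℓ')).filter
      (fun n : ℕ => ∀ p ∈ n.primeFactors, P x ≤ (p : ℝ)), |(μ n₀ : ℝ) * A.a (n₀ * ℓ')| := fun ℓ' v => by
    simpa only [abs_abs] using hΨsb ℓ' v
  have hΨsq : ∀ ℓ', ¬Squarefree ℓ' → ∀ v, Ψs ℓ' v = 0 := by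
    intro ℓ' hℓ' v
    refine Finset.sum_eq_zero fun n₀ _ => ?_
    have : ¬Squarefree (n₀ * ℓ') := fun h => hℓ' (Squarefree.of_mul_right h)
    rw [h116 _ this, mul_zero, ite_self]
  have hspiece : ∀ (ℓ' : ℕ) (ν : ℝ) {a b : ℝ}, 0 < a → a ≤ b →
      IntervalIntegrable (fun y => |Ψs ℓ' (y / ν)| / y) volume a b := fun ℓ' ν a b ha hab =>
    intervalIntegrable_comp_div_div (h := fun v => |Ψs ℓ' v|) (hΨsam ℓ') (hΨsab ℓ') ν ha hab
  have hspiece1 : ∀ (ℓ' : ℕ) {a b : ℝ}, 0 < a → a ≤ b →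
      IntervalIntegrable (fun v => |Ψs ℓ' v| / v) volume a b := fun ℓ' a b ha hab => by
    simpa only [div_one] using hspiece ℓ' 1 ha hab
  have hF0int : IntervalIntegrable (fun u => F0 u / u) volume (Y / L) (Real.exp 1 * Y) := by
    have hfun : (fun u => F0 u / u) = fun u => ∑ ℓ ∈ Icc 1 X, ∑ n₁ ∈ SMle ℓ,
        (divisorCountK 3 ℓ : ℝ) * (|Ψs (ℓ * n₁) (u / n₁)| / u) := by
      funext u
      rw [hF0]
      dsimp only
      rw [Finset.sum_div]
      refine Finset.sum_congr rfl fun ℓ _ => ?_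
      rw [Finset.mul_sum, Finset.sum_div]
      exact Finset.sum_congr rfl fun n₁ _ => by ring
    rw [hfun]
    exact intervalIntegrable_finset_sum_fun _ fun ℓ _ =>
      intervalIntegrable_finset_sum_fun _ fun n₁ _ => (hspiece (ℓ * n₁) n₁ hYL0 hYLe).const_mul _
  have hYLLe : Y / L / L ≤ Real.exp 1 * Y := (div_le_self hYL0.le hL1).trans hYLe
  have hW0 : ∫ u in (Y / L)..(Real.exp 1 * Y), F0 u / u ≤ (k₀ * KB') * (1 + 2 * Real.log L) := by
    -- push the integral inside and change variables `v = u/n₁`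
    set I : ℕ → ℝ := fun ℓ' => ∫ v in (Y / L / L)..(Real.exp 1 * Y), |Ψs ℓ' v| / v with hI
    have hI0 : ∀ ℓ', 0 ≤ I ℓ' := fun ℓ' =>
      intervalIntegral.integral_nonneg hYLLe fun v hv => div_nonneg (abs_nonneg _) (hYLL0.le.trans hv.1)
    have hIsq : ∀ ℓ', ¬Squarefree ℓ' → I ℓ' = 0 := by
      intro ℓ' hℓ'
      rw [hI]
      dsimp only
      simp_rw [hΨsq ℓ' hℓ', abs_zero, zero_div]
      exact intervalIntegral.integral_zero
    have h1 : ∫ u in (Y / L)..(Real.exp 1 * Y), F0 u / u =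
        ∑ ℓ ∈ Icc 1 X, ∑ n₁ ∈ SMle ℓ, (divisorCountK 3 ℓ : ℝ) *
          ∫ u in (Y / L)..(Real.exp 1 * Y), |Ψs (ℓ * n₁) (u / n₁)| / u := by
      have hfun : (fun u => F0 u / u) = fun u => ∑ ℓ ∈ Icc 1 X, ∑ n₁ ∈ SMle ℓ,
          (divisorCountK 3 ℓ : ℝ) * (|Ψs (ℓ * n₁) (u / n₁)| / u) := by
        funext u
        rw [hF0]
        dsimp only
        rw [Finset.sum_div]
        refine Finset.sum_congr rfl fun ℓ _ => ?_
        rw [Finset.mul_sum, Finset.sum_div]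
        exact Finset.sum_congr rfl fun n₁ _ => by ring
      rw [hfun, intervalIntegral.integral_finsetSum (fun ℓ _ =>
        intervalIntegrable_finset_sum_fun _ fun n₁ _ => (hspiece (ℓ * n₁) n₁ hYL0 hYLe).const_mul _)]
      refine Finset.sum_congr rfl fun ℓ _ => ?_
      rw [intervalIntegral.integral_finsetSum (fun n₁ _ => (hspiece (ℓ * n₁) n₁ hYL0 hYLe).const_mul _)]
      refine Finset.sum_congr rfl fun n₁ _ => ?_
      exact intervalIntegral.integral_const_mul _ _
    have h2 : (∑ ℓ ∈ Icc 1 X, ∑ n₁ ∈ SMle ℓ, (divisorCountK 3 ℓ : ℝ) *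
          ∫ u in (Y / L)..(Real.exp 1 * Y), |Ψs (ℓ * n₁) (u / n₁)| / u) ≤
        ∑ ℓ ∈ Icc 1 X, (divisorCountK 3 ℓ : ℝ) * ∑ n₁ ∈ SMle ℓ, I (ℓ * n₁) := by
      refine Finset.sum_le_sum fun ℓ _ => ?_
      rw [Finset.mul_sum]
      refine Finset.sum_le_sum fun n₁ hn₁ => mul_le_mul_of_nonneg_left ?_ (Nat.cast_nonneg _)
      obtain ⟨hI1, -, -, hνL⟩ := Finset.mem_filter.mp hn₁
      exact intervalIntegral_comp_div_le_gen (h := fun v => |Ψs (ℓ * n₁) v|) (hΨsam _)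
        (fun v => abs_nonneg _) (fun v => hΨsb _ v) hYL0 hYLe (by exact_mod_cast (Finset.mem_Icc.mp hI1).1) hνL
    have h3 : ∑ ℓ ∈ Icc 1 X, (divisorCountK 3 ℓ : ℝ) * ∑ n₁ ∈ SMle ℓ, I (ℓ * n₁) ≤
        ∑ ℓ' ∈ Icc 1 X, (6 : ℝ) ^ ℓ'.primeFactors.card * I ℓ' :=
      sum_tau3_sum_mul_le hI0 hIsq X _
    have h4 : ∑ ℓ' ∈ Icc 1 X, (6 : ℝ) ^ ℓ'.primeFactors.card * I ℓ' ≤ (k₀ * KB') * (1 + 2 * Real.log L) := by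
      have h41 : ∑ ℓ' ∈ Icc 1 X, (6 : ℝ) ^ ℓ'.primeFactors.card * I ℓ' =
          ∫ v in (Y / L / L)..(Real.exp 1 * Y), ∑ ℓ' ∈ Icc 1 X,
            (6 : ℝ) ^ ℓ'.primeFactors.card * (|Ψs ℓ' v| / v) := by
        rw [intervalIntegral.integral_finsetSum (fun ℓ' _ => (hspiece1 ℓ' hYLL0 hYLLe).const_mul _)]
        refine Finset.sum_congr rfl fun ℓ' _ => ?_
        rw [hI]
        exact (intervalIntegral.integral_const_mul _ _).symm
      rw [h41]
      have hpt : ∀ v ∈ Set.Ioo (Y / L / L) (Real.exp 1 * Y),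
          (∑ ℓ' ∈ Icc 1 X, (6 : ℝ) ^ ℓ'.primeFactors.card * (|Ψs ℓ' v| / v)) ≤ (k₀ * KB') * v⁻¹ := by
        intro v hv
        have hv0 : 0 < v := hYLL0.trans hv.1
        have hsum : ∑ ℓ' ∈ Icc 1 X, (6 : ℝ) ^ ℓ'.primeFactors.card * |Ψs ℓ' v| ≤ k₀ * KB' :=
          sum_six_pow_abs_rough_innerS2_le h116 (P x) hx0.le hv0.le k₀ (fun i hi => hB6' v hv i hi)
        have heq : (∑ ℓ' ∈ Icc 1 X, (6 : ℝ) ^ ℓ'.primeFactors.card * (|Ψs ℓ' v| / v)) =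
            v⁻¹ * ∑ ℓ' ∈ Icc 1 X, (6 : ℝ) ^ ℓ'.primeFactors.card * |Ψs ℓ' v| := by
          rw [Finset.mul_sum]
          exact Finset.sum_congr rfl fun ℓ' _ => by rw [div_eq_mul_inv]; ring
        rw [heq]
        calc v⁻¹ * ∑ ℓ' ∈ Icc 1 X, (6 : ℝ) ^ ℓ'.primeFactors.card * |Ψs ℓ' v| ≤ v⁻¹ * (k₀ * KB') :=
              mul_le_mul_of_nonneg_left hsum (inv_nonneg.mpr hv0.le)
          _ = (k₀ * KB') * v⁻¹ := mul_comm _ _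
      have hinv' : IntervalIntegrable (fun v : ℝ => (k₀ * KB') * v⁻¹) volume (Y / L / L) (Real.exp 1 * Y) := by
        refine (intervalIntegral.intervalIntegrable_inv (fun v hv => ?_) continuousOn_id).const_mul _
        rw [Set.uIcc_of_le hYLLe] at hv
        exact (hYLL0.trans_le hv.1).ne'
      have hle : (∫ v in (Y / L / L)..(Real.exp 1 * Y), ∑ ℓ' ∈ Icc 1 X,
            (6 : ℝ) ^ ℓ'.primeFactors.card * (|Ψs ℓ' v| / v)) ≤
          ∫ v in (Y / L / L)..(Real.exp 1 * Y), (k₀ * KB') * v⁻¹ := by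
        refine intervalIntegral.integral_mono_on_of_le_Ioo hYLLe ?_ hinv' hpt
        exact intervalIntegrable_finset_sum_fun _ fun ℓ' _ => (hspiece1 ℓ' hYLL0 hYLLe).const_mul _
      have hval : (∫ v in (Y / L / L)..(Real.exp 1 * Y), (k₀ * KB') * v⁻¹) = (k₀ * KB') * (1 + 2 * Real.log L) := by
        rw [intervalIntegral.integral_const_mul, integral_inv (Set.notMem_uIcc_of_lt hYLL0 (by positivity))]
        congr 1
        have : Real.exp 1 * Y / (Y / L / L) = Real.exp 1 * (L * L) := by
          field_simp
          rw [div_self hY0.ne']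
        rw [this, Real.log_mul (Real.exp_pos 1).ne' (by positivity), Real.log_exp,
          Real.log_mul hL0.ne' hL0.ne']
        ring
      exact hle.trans (le_of_eq hval)
    calc ∫ u in (Y / L)..(Real.exp 1 * Y), F0 u / u
        = ∑ ℓ ∈ Icc 1 X, ∑ n₁ ∈ SMle ℓ, (divisorCountK 3 ℓ : ℝ) *
            ∫ u in (Y / L)..(Real.exp 1 * Y), |Ψs (ℓ * n₁) (u / n₁)| / u := h1
      _ ≤ ∑ ℓ ∈ Icc 1 X, (divisorCountK 3 ℓ : ℝ) * ∑ n₁ ∈ SMle ℓ, I (ℓ * n₁) := h2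
      _ ≤ ∑ ℓ' ∈ Icc 1 X, (6 : ℝ) ^ ℓ'.primeFactors.card * I ℓ' := h3
      _ ≤ (k₀ * KB') * (1 + 2 * Real.log L) := h4
  -- integrate the pointwise bound
  have hinv : IntervalIntegrable (fun u : ℝ => E6 * u⁻¹) volume (Y / L) (Real.exp 1 * Y) := by
    refine (intervalIntegral.intervalIntegrable_inv (fun u hu => ?_) continuousOn_id).const_mul _
    rw [Set.uIcc_of_le hYLe] at hu
    exact (hYL0.trans_le hu.1).ne'
  have hrhsint : IntervalIntegrable (fun u => Real.log x * ((F0 u + E6) * u⁻¹)) volume (Y / L)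
      (Real.exp 1 * Y) := by
    have : (fun u => Real.log x * ((F0 u + E6) * u⁻¹)) = fun u => Real.log x * (F0 u / u + E6 * u⁻¹) := by
      funext u; ring
    rw [this]
    exact (hF0int.add hinv).const_mul _
  have hEle : (∫ u in (Y / L)..(Real.exp 1 * Y),
        ∑ k ∈ Icc 1 X, ∑ ν ∈ Icc 1 ⌊L⌋₊, c k * (|Ψ (ν * k) u| / u)) ≤
      ∫ u in (Y / L)..(Real.exp 1 * Y), Real.log x * ((F0 u + E6) * u⁻¹) := by
    refine intervalIntegral.integral_mono_on_of_le_Ioo hYLe ?_ hrhsint hpt2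
    exact intervalIntegrable_finset_sum_fun _ fun k _ =>
      intervalIntegrable_finset_sum_fun _ fun ν _ => (hpiece1 (ν * k) hYL0 hYLe).const_mul _
  have hEeq : (∫ u in (Y / L)..(Real.exp 1 * Y), Real.log x * ((F0 u + E6) * u⁻¹)) =
      Real.log x * ((∫ u in (Y / L)..(Real.exp 1 * Y), F0 u / u) + E6 * (1 + Real.log L)) := by
    have : (fun u => Real.log x * ((F0 u + E6) * u⁻¹)) = fun u => Real.log x * (F0 u / u + E6 * u⁻¹) := by
      funext u; ring
    rw [this, intervalIntegral.integral_const_mul, intervalIntegral.integral_add hF0int hinv,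
      intervalIntegral.integral_const_mul, integral_inv (Set.notMem_uIcc_of_lt hYL0 (by positivity))]
    congr 2
    congr 1
    have : Real.exp 1 * Y / (Y / L) = Real.exp 1 * L := by
      rw [div_div_eq_mul_div, mul_assoc, mul_comm Y L, ← mul_assoc, mul_div_assoc, div_self hY0.ne',
        mul_one]
    rw [this, Real.log_mul (Real.exp_pos 1).ne' hL0.ne', Real.log_exp]
  -- Step (F): numerics
  have hlogL : Real.log L ≤ Real.log x := Real.log_le_log hL0 hLx
  have hlogL0 : 0 ≤ Real.log L := Real.log_nonneg hL1
  have hF : Real.log x * ((∫ u in (Y / L)..(Real.exp 1 * Y), F0 u / u) + E6 * (1 + Real.log L)) ≤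
      (12 * K₀ + 2 * C6) * A.size x / Real.log x := by
    have h1 : (∫ u in (Y / L)..(Real.exp 1 * Y), F0 u / u) ≤ (4 * Real.log x * KB') * (3 * Real.log x) := by
      refine hW0.trans ?_
      exact mul_le_mul (mul_le_mul_of_nonneg_right hk₀ hKB'0) (by linarith) (by linarith) (by positivity)
    have h2 : E6 * (1 + Real.log L) ≤ (C6 * A.size x / Real.log x ^ 7) * (2 * Real.log x) :=
      mul_le_mul hE6le (by linarith) (by linarith) (by positivity)
    have h3 : Real.log x * ((4 * Real.log x * KB') * (3 * Real.log x)) = 12 * K₀ * A.size x / Real.log x ^ 2 := by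
      rw [hKB']; field_simp; ring
    have h4 : Real.log x * ((C6 * A.size x / Real.log x ^ 7) * (2 * Real.log x)) = 2 * C6 * A.size x / Real.log x ^ 5 := by
      field_simp
    have h5 : 12 * K₀ * A.size x / Real.log x ^ 2 ≤ 12 * K₀ * A.size x / Real.log x := by
      refine div_le_div_of_nonneg_left (by positivity) hlogx0 ?_
      calc Real.log x = Real.log x ^ 1 := (pow_one _).symm
        _ ≤ Real.log x ^ 2 := pow_le_pow_right₀ hlogx (by norm_num)
    have h6 : 2 * C6 * A.size x / Real.log x ^ 5 ≤ 2 * C6 * A.size x / Real.log x := by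
      refine div_le_div_of_nonneg_left (by positivity) hlogx0 ?_
      calc Real.log x = Real.log x ^ 1 := (pow_one _).symm
        _ ≤ Real.log x ^ 5 := pow_le_pow_right₀ hlogx (by norm_num)
    calc Real.log x * ((∫ u in (Y / L)..(Real.exp 1 * Y), F0 u / u) + E6 * (1 + Real.log L))
        ≤ Real.log x * ((4 * Real.log x * KB') * (3 * Real.log x) +
            (C6 * A.size x / Real.log x ^ 7) * (2 * Real.log x)) :=
          mul_le_mul_of_nonneg_left (add_le_add h1 h2) hlogx0.le
      _ = 12 * K₀ * A.size x / Real.log x ^ 2 + 2 * C6 * A.size x / Real.log x ^ 5 := by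
          rw [mul_add, h3, h4]
      _ ≤ 12 * K₀ * A.size x / Real.log x + 2 * C6 * A.size x / Real.log x := add_le_add h5 h6
      _ = (12 * K₀ + 2 * C6) * A.size x / Real.log x := by ring
  -- conclusion
  calc |A.fiS2Y (lam x) (2 ^ k₀) x Y z| ≤ ∫ y in Y..(Real.exp 1 * Y), G y := hA
    _ = ∑ k ∈ Icc 1 X, ∑ ν ∈ Icc 1 ⌊L⌋₊,
          c k * ∫ y in Y..(Real.exp 1 * Y), |Ψ (ν * k) (y / ν)| / y := hBeq
    _ ≤ ∑ k ∈ Icc 1 X, ∑ ν ∈ Icc 1 ⌊L⌋₊,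
          c k * ∫ u in (Y / L)..(Real.exp 1 * Y), |Ψ (ν * k) u| / u := hCle
    _ = ∫ u in (Y / L)..(Real.exp 1 * Y),
          ∑ k ∈ Icc 1 X, ∑ ν ∈ Icc 1 ⌊L⌋₊, c k * (|Ψ (ν * k) u| / u) := hDeq
    _ ≤ ∫ u in (Y / L)..(Real.exp 1 * Y), Real.log x * ((F0 u + E6) * u⁻¹) := hEle
    _ = Real.log x * ((∫ u in (Y / L)..(Real.exp 1 * Y), F0 u / u) + E6 * (1 + Real.log L)) := hEeq
    _ ≤ (12 * K₀ + 2 * C6) * A.size x / Real.log x := hF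

/-- **FI (7.2) under (B*)**: `S₂(x; Y, z) ≪ A(x)(log x)⁻¹` over `FIRegimeRough` — discharge of the
named fact `fi_asp_S2_estimate_rough` (`…Rough`): the case `K_B* = 1` of
`fi_asp_S2_estimate_roughK` (the bundled hypotheses `FIAsymptoticSieveHypothesesRough` demand (B*)
with the explicit constant `1`, `FIAsymptoticSieveHypothesesRough.bilinear_const`).
[cite: FriedlanderIwaniecASP1998, §7 (7.2) and §10 Theorem 3] -/
theorem fi_asp_S2_estimate_rough_holds : fi_asp_S2_estimate_rough :=
  fun A D α θ θ₁ lam P hreg => fi_asp_S2_estimate_roughK A D α θ θ₁ lam P hreg.α_pos hreg.θ₁_pos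
    hreg.θ₁_le hreg.θ_lt hreg.hyp.core hreg.hyp.params hreg.hyp.bilinear_const hreg.weights

end Literature.NumberTheory.Sieve
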